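import Summits.QuantumFields.YangMills.Theorems.UnitScaleTiltProp7CovHodgeConstraint
import Summits.QuantumFields.YangMills.Theorems.UnitScaleTiltProp7CovIterLambdaHLambdaCurl
import Summits.QuantumFields.YangMills.Theorems.UnitScaleTiltProp7CurvedLandauKnitT3
import HarnessLib

/-!
# Route `UnitScaleTilt`, crux K1 «MinimiserStabilityRegPr» (stmt-QuantumFields-19200), route-R E′ (α′), S3 K-form engine (DESIGN-S3-KFORM-ENGINE-g15) — ROW R2′ PRE-COMPOSED:
# the covariant constraint split read on the covariant Hodge parts `Y = B + D_{U₀}φ` at the comparison level `K − n`, with the per-level guards DISCHARGED from the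
# (14)-type plaquette bound, AND the landed `(H¹)*`-bound of the coarse gauge family `Λ(B)` in (K)+(eM) currencies (`D*_{U₀}B = 0` kills the divergence form)

Cell `ym3-torus`, width seat `ym-ust-19200-w4` (gen 6); ★p1 g15 2026-08-28 20:45Z «w4: R2′-COROLLARY GO» on this seat's `LOCATE-R2PRIME-COVCONSTRAINT-w4g6.md` (19200 evidence).
THEOREMS ONLY (0 `def`, 0 `sorry`); `--supports stmt-QuantumFields-19200`, count-neutral.  YM₃ on T³ is a ladder rung (R3), not the Clay problem; nothing here claims S3, E′,
the stub, the crux, d = 4 or the mass gap.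

WHY.  R2′ of the K-form engine is IN THE TREE BY NAME (LOCATE): the identity ✓`Prop7CovHodgeConstraint.covConstraint_on_hodge_parts_covD` is EXACT (the pure gauge passes through the
true linearised (0.4)-average as the coarse covariant pure gauge of the centre values, ✓`trueLinIter_pureGauge`; no transport junk), and the `(H¹)*`-bound of the coarse gauge family is
✓`Prop7CovIterLambdaHLambdaCurl.sum_normSq_covIterLambda_le_curl_T3_su2` (ℓ²-sum over the centres; curl + divergence + `e`-mass forms).  This file composes the two for the
assembler R5: same background `U₀` with `dist1(U₀(∂p)) ≤ ε·L^{−2(K−n)}`, `10⁶L⁵ε ≤ 1`; the SAME recursion families of record (`Q` true linearised iterate, `G` reduced, `S` pure LINE,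
`Λ` coarse gauge at the stair-word comb mean — displayed by their recursions, inhabited by ✓`exists_trueLinIter_family`∕`exists_reduced_family`∕`exists_coarseGauge_family`∕
`exists_pureLine_family`) but now OF THE CO-CLOSED PART `B` of a covariant Hodge split `Y = B + D_{U₀}φ` (✓`exists_covHodgeSplit_T3`); the guards `dist1(W^{(j)}_i(c)) < δ₂`, `j < K − n`,
are discharged by ✓`Prop7CovIterLambdaBound.tower_guard` through ✓`Prop7CurvedLandauKnitT3.smallness_T3`.  OUTPUT (per `(K−n)`-bond `c`, and summed over the centres):
  `G_{K−n}(B)(c) + [(Λ_{K−n}(c₋) − φ(embIter c₋)) − Ū₀^{(K−n)}(c)(Λ_{K−n}(c₊) − φ(embIter c₊))Ū₀^{(K−n)}(c)*] = Q^{(K−n)}Y(c)`  (the DESIGN memo's «`ℓ·Q_WB + δ^V(φ₀|_C) = δ^VΛ + q`»,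
  `ρ ≡ 0`), and `Σ_y‖Λ_{K−n}(y)‖² ≤ L^{K−n}·(200L⁴·CURL_HS(B) + 4·10⁹·L⁹·ε·L^{−2(K−n)}·Σ_b‖B b‖²)` — currencies (K of `B`) and (eM) only; `φ` enters ONLY through its centre values.

WHAT IS PROVED (ns `…Theorems.Prop7CovConstraintSplitOfRegPr`; T³, `SU(2)`): `sum_hs_divB_eq_zero_of_coclosed` (the divergence form of a co-closed field vanishes),
★★ `covConstraintSplit_coclosed_T3` (the displayed pair).  HONEST SCOPE.  Composition of landed theorems; the reduced-vs-LINE∕FACE passage of `G_{K−n}(B)` (R3′) and LEMMA-H (R4)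
are not here; nothing of S3 is closed.

References: T. Bałaban, CMP 95 (1984) 17–40 [Balaban1984PropagatorsI] ((1.18)–(1.20) pp.19–20); CMP 98 (1985) 17–51 [Balaban1985Averaging] ((11)–(13) p.19); CMP 99 (1985) 389–434
[Balaban1985BackgroundPropagators] ((3.3) p.390, (3.8) p.392, Thm 3.11 p.416); CMP 102 (1985) 277–309 [Balaban1985Variational] ((14) p.280, (135) p.298, Prop. 7 p.299).
-/

set_option autoImplicit false

noncomputable section

open scoped BigOperators Matrix.Norms.L2Operator Matrix

namespace Summit.QuantumFields.YangMills.Theorems.Prop7CovConstraintSplitOfRegPr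

open Literature.MathematicalPhysics.QuantumFieldTheory.Balaban1983to89
open Literature.MathematicalPhysics.QuantumFieldTheory.Balaban1983to89.T3ContinuumYM3Torus
open Finset T4Continuum T4ReflectionCone BlockAveraging AveragingRT ExpMeanLog BlockAveragingEMLLinearised BlockAveragingEMLLinearisedBackground
  BlockAveragingEMLProp2 B1RG242Torus
open B15DeterminingSets (embIter)
open B9Eq39Adjoint (curl divB)
open B10Eq27TorusAxialLog (unitsField toUField)
open B9TorusCalculus (torusT)
open Summit.QuantumFields.YangMills.Theorems.Prop7CovIterLambdaBound (tower_guard plaqSmall_of_le_of_lt)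
open Summit.QuantumFields.YangMills.Theorems.Prop7CurvedLandauKnitT3 (smallness_T3)
open Summit.QuantumFields.YangMills.Theorems.Prop7CovHodgeConstraint (covConstraint_on_hodge_parts_covD)
open Summit.QuantumFields.YangMills.Theorems.Prop7CovIterLambdaHLambdaCurl (sum_normSq_covIterLambda_le_curl_T3_su2)

/-- The divergence form of a covariantly co-closed bond field vanishes (bookkeeping for the `D*_{U₀}B = 0` output of ✓`exists_covHodgeSplit_T3`).
[cite: Balaban1985BackgroundPropagators, (3.8) p.392] -/
theorem sum_hs_divB_eq_zero_of_coclosed (F : T3Family) (K : ℕ) (U₀ : GaugeField (F.P K) 0 (Matrix.specialUnitaryGroup (Fin 2) ℂ))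
    (B : PBond (F.P K) 0 → Matrix (Fin 2) (Fin 2) ℂ)
    (hB : ∀ x : Site (F.P K) 0, divB (torusT (F.P K) 0) (fun κ z => unitsField (toUField U₀) ⟨z, κ⟩) (fun κ z => B ⟨z, κ⟩) x = 0) :
    (∑ x : Site (F.P K) 0, ∑ j : Fin 2, ∑ k : Fin 2,
                  ‖(divB (torusT (F.P K) 0) (fun κ z => unitsField (toUField U₀) ⟨z, κ⟩) (fun κ z => B ⟨z, κ⟩) x) j k‖ ^ 2) = 0 := by
  refine Finset.sum_eq_zero fun x _ => ?_
  rw [hB x]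
  simp

set_option maxHeartbeats 400000 in
/-- ★★ **R2′ PRE-COMPOSED (T³, `SU(2)`, comparison level `K − n`).**  Background `U₀` with `dist1(U₀(∂p)) ≤ ε·L^{−2(K−n)}`, `0 < ε`, `10⁶·L⁵·ε ≤ 1`; `Q` the true linearised
iterate (recursion displayed); a covariant Hodge split `Y = B + D_{U₀}φ` with `D*_{U₀}B = 0`; the reduced ∕ pure-LINE ∕ coarse-gauge families `G`, `S`, `Λ` OF `B` (recursions displayed,
the families of record of ✓`sum_normSq_covIterLambda_le_curl_T3_su2`).  THEN (i) for every `(K−n)`-bond `c`,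
`G (K−n) c + [(Λ (K−n) c₋ − φ(embIter (K−n) c₋)) − Ū₀^{(K−n)}(c)·(Λ (K−n) c₊ − φ(embIter (K−n) c₊))·Ū₀^{(K−n)}(c)*] = Q (K−n) Y c` (EXACT; the guards discharged from the plaquette
bound), and (ii) `Σ_y‖Λ (K−n) y‖² ≤ L^{K−n}·(200·L⁴·Σ_{x,μ<ν}‖(D_{U₀}B)(p_{μν}(x))‖²_HS + 4·10⁹·L⁹·ε·L^{−2(K−n)}·Σ_b‖B b‖²)`.
[cite: Balaban1984PropagatorsI, (1.18)-(1.20) pp.19-20; Balaban1985Averaging, (11) p.19; Balaban1985BackgroundPropagators, Thm 3.11 p.416; Balaban1985Variational, (14) p.280, Prop. 7 p.299] -/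
theorem covConstraintSplit_coclosed_T3 (F : T3Family) (n K : ℕ)
    (U₀ : GaugeField (F.P K) 0 (Matrix.specialUnitaryGroup (Fin 2) ℂ)) {ε : ℝ} (hε : 0 < ε)
    (hεL : 1000000 * (F.L : ℝ) ^ 5 * ε ≤ 1)
    (hU : ∀ p : Plaq (F.P K) 0, dist1 (GaugeField.plaqHol U₀ p) ≤ ε * (((F.L : ℝ) ^ (K - n)) ^ 2)⁻¹)
    (Q : (k : ℕ) → (PBond (F.P K) 0 → Matrix (Fin 2) (Fin 2) ℂ) → PBond (F.P K) k → Matrix (Fin 2) (Fin 2) ℂ) (hQ0 : ∀ Y, Q 0 Y = Y)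
    (hQs : ∀ (k : ℕ) (Y : PBond (F.P K) 0 → Matrix (Fin 2) (Fin 2) ℂ) (c : PBond (F.P K) (k + 1)), Q (k + 1) Y c
      = fderiv ℂ (eml : (Idx (F.P K) → Matrix (Fin 2) (Fin 2) ℂ) → Matrix (Fin 2) (Fin 2) ℂ)
            (fun i => ((loopHol (Averaging.iter (fun i => blockAvg (P := F.P K) (j := i) (expMeanLogSU (n := Fin 2))) k U₀) c i :
              Matrix.specialUnitaryGroup (Fin 2) ℂ) : Matrix (Fin 2) (Fin 2) ℂ))
            (fun i => covWalkSum (Averaging.iter (fun i => blockAvg (P := F.P K) (j := i) (expMeanLogSU (n := Fin 2))) k U₀) (Q k Y)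
                (walk (emb c.src) (loopWord (F.P K).L c.dir (off i.1) i.2.1 i.2.2))
              * ((loopHol (Averaging.iter (fun i => blockAvg (P := F.P K) (j := i) (expMeanLogSU (n := Fin 2))) k U₀) c i :
                Matrix.specialUnitaryGroup (Fin 2) ℂ) : Matrix (Fin 2) (Fin 2) ℂ))
            * star ((corr (expMeanLogSU (n := Fin 2)) (Averaging.iter (fun i => blockAvg (P := F.P K) (j := i) (expMeanLogSU (n := Fin 2))) k U₀) c :
                Matrix.specialUnitaryGroup (Fin 2) ℂ) : Matrix (Fin 2) (Fin 2) ℂ)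
          + ((corr (expMeanLogSU (n := Fin 2)) (Averaging.iter (fun i => blockAvg (P := F.P K) (j := i) (expMeanLogSU (n := Fin 2))) k U₀) c :
                Matrix.specialUnitaryGroup (Fin 2) ℂ) : Matrix (Fin 2) (Fin 2) ℂ)
            * covWalkSum (Averaging.iter (fun i => blockAvg (P := F.P K) (j := i) (expMeanLogSU (n := Fin 2))) k U₀) (Q k Y)
                (walk (emb c.src) (List.replicate (F.P K).L (c.dir, true)))
            * star ((corr (expMeanLogSU (n := Fin 2)) (Averaging.iter (fun i => blockAvg (P := F.P K) (j := i) (expMeanLogSU (n := Fin 2))) k U₀) c :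
                Matrix.specialUnitaryGroup (Fin 2) ℂ) : Matrix (Fin 2) (Fin 2) ℂ))
    (Y B : PBond (F.P K) 0 → Matrix (Fin 2) (Fin 2) ℂ) (φ : Site (F.P K) 0 → Matrix (Fin 2) (Fin 2) ℂ)
    (hY : ∀ b : PBond (F.P K) 0, Y b = B b
        + B9Eq39Adjoint.covD (torusT (F.P K) 0) (fun κ z => unitsField (toUField U₀) ⟨z, κ⟩) b.dir φ b.src)
    (hB : ∀ x : Site (F.P K) 0, divB (torusT (F.P K) 0) (fun κ z => unitsField (toUField U₀) ⟨z, κ⟩) (fun κ z => B ⟨z, κ⟩) x = 0)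
    (G S : (j : ℕ) → PBond (F.P K) j → Matrix (Fin 2) (Fin 2) ℂ) (Λ : (j : ℕ) → Site (F.P K) j → Matrix (Fin 2) (Fin 2) ℂ)
    (hΛ0 : ∀ y, Λ 0 y = 0) (hG0 : ∀ b, G 0 b = B b) (hS0 : ∀ b, S 0 b = B b)
    (hΛs : ∀ (j : ℕ) (z : Site (F.P K) (j + 1)), Λ (j + 1) z
      = ((Fintype.card (Idx (F.P K)) : ℂ))⁻¹ • ∑ i : Idx (F.P K),
          covWalkSum (Averaging.iter (fun i => blockAvg (P := F.P K) (j := i) (expMeanLogSU (n := Fin 2))) j U₀) (G j)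
            (walk (emb z) (stairWord i.2.1 (off i.1)))
        + Λ j (emb z))
    (hGs : ∀ (k : ℕ) (c : PBond (F.P K) (k + 1)), G (k + 1) c
      = (fderiv ℂ (eml : (Idx (F.P K) → Matrix (Fin 2) (Fin 2) ℂ) → Matrix (Fin 2) (Fin 2) ℂ)
            (fun i => ((loopHol (Averaging.iter (fun i => blockAvg (P := F.P K) (j := i) (expMeanLogSU (n := Fin 2))) k U₀) c i :
              Matrix.specialUnitaryGroup (Fin 2) ℂ) : Matrix (Fin 2) (Fin 2) ℂ))
            (fun i => covWalkSum (Averaging.iter (fun i => blockAvg (P := F.P K) (j := i) (expMeanLogSU (n := Fin 2))) k U₀) (G k)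
                (walk (emb c.src) (loopWord (F.P K).L c.dir (off i.1) i.2.1 i.2.2))
              * ((loopHol (Averaging.iter (fun i => blockAvg (P := F.P K) (j := i) (expMeanLogSU (n := Fin 2))) k U₀) c i :
                Matrix.specialUnitaryGroup (Fin 2) ℂ) : Matrix (Fin 2) (Fin 2) ℂ))
            * star ((corr (expMeanLogSU (n := Fin 2)) (Averaging.iter (fun i => blockAvg (P := F.P K) (j := i) (expMeanLogSU (n := Fin 2))) k U₀) c :
                Matrix.specialUnitaryGroup (Fin 2) ℂ) : Matrix (Fin 2) (Fin 2) ℂ)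
          + ((corr (expMeanLogSU (n := Fin 2)) (Averaging.iter (fun i => blockAvg (P := F.P K) (j := i) (expMeanLogSU (n := Fin 2))) k U₀) c :
                Matrix.specialUnitaryGroup (Fin 2) ℂ) : Matrix (Fin 2) (Fin 2) ℂ)
            * covWalkSum (Averaging.iter (fun i => blockAvg (P := F.P K) (j := i) (expMeanLogSU (n := Fin 2))) k U₀) (G k)
                (walk (emb c.src) (List.replicate (F.P K).L (c.dir, true)))
            * star ((corr (expMeanLogSU (n := Fin 2)) (Averaging.iter (fun i => blockAvg (P := F.P K) (j := i) (expMeanLogSU (n := Fin 2))) k U₀) c :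
                Matrix.specialUnitaryGroup (Fin 2) ℂ) : Matrix (Fin 2) (Fin 2) ℂ))
        - ((((Fintype.card (Idx (F.P K)) : ℂ))⁻¹ • ∑ i : Idx (F.P K),
              covWalkSum (Averaging.iter (fun i => blockAvg (P := F.P K) (j := i) (expMeanLogSU (n := Fin 2))) k U₀) (G k) (walk (emb c.src) (stairWord i.2.1 (off i.1))))
            - ((Averaging.iter (fun i => blockAvg (P := F.P K) (j := i) (expMeanLogSU (n := Fin 2))) (k + 1) U₀ c : Matrix.specialUnitaryGroup (Fin 2) ℂ) :
                Matrix (Fin 2) (Fin 2) ℂ)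
              * (((Fintype.card (Idx (F.P K)) : ℂ))⁻¹ • ∑ i : Idx (F.P K),
                  covWalkSum (Averaging.iter (fun i => blockAvg (P := F.P K) (j := i) (expMeanLogSU (n := Fin 2))) k U₀) (G k) (walk (emb c.tgt) (stairWord i.2.1 (off i.1))))
              * star ((Averaging.iter (fun i => blockAvg (P := F.P K) (j := i) (expMeanLogSU (n := Fin 2))) (k + 1) U₀ c :
                Matrix.specialUnitaryGroup (Fin 2) ℂ) : Matrix (Fin 2) (Fin 2) ℂ)))
    (hSs : ∀ (k : ℕ) (c : PBond (F.P K) (k + 1)), S (k + 1) c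
      = ((Fintype.card (Idx (F.P K)) : ℂ))⁻¹ • ∑ i : Idx (F.P K),
          ((holAt (Averaging.iter (fun i => blockAvg (P := F.P K) (j := i) (expMeanLogSU (n := Fin 2))) k U₀) (walk (emb c.src) (stairWord i.2.1 (off i.1))) :
              Matrix.specialUnitaryGroup (Fin 2) ℂ) : Matrix (Fin 2) (Fin 2) ℂ) *
            covWalkSum (Averaging.iter (fun i => blockAvg (P := F.P K) (j := i) (expMeanLogSU (n := Fin 2))) k U₀) (S k)
              (walk (walkEnd (emb c.src) (stairWord i.2.1 (off i.1))) (List.replicate (F.P K).L (c.dir, true))) *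
          star ((holAt (Averaging.iter (fun i => blockAvg (P := F.P K) (j := i) (expMeanLogSU (n := Fin 2))) k U₀) (walk (emb c.src) (stairWord i.2.1 (off i.1))) :
              Matrix.specialUnitaryGroup (Fin 2) ℂ) : Matrix (Fin 2) (Fin 2) ℂ))
    :
    (∀ c : PBond (F.P K) (K - n),
        G (K - n) c + ((Λ (K - n) c.src - φ (embIter (K - n) c.src))
            - ((Averaging.iter (fun i => blockAvg (P := F.P K) (j := i) (expMeanLogSU (n := Fin 2))) (K - n) U₀ c : Matrix.specialUnitaryGroup (Fin 2) ℂ) :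
                Matrix (Fin 2) (Fin 2) ℂ)
              * (Λ (K - n) c.tgt - φ (embIter (K - n) c.tgt))
              * star ((Averaging.iter (fun i => blockAvg (P := F.P K) (j := i) (expMeanLogSU (n := Fin 2))) (K - n) U₀ c : Matrix.specialUnitaryGroup (Fin 2) ℂ) :
                Matrix (Fin 2) (Fin 2) ℂ))
          = Q (K - n) Y c) ∧
    ∑ y : Site (F.P K) (K - n), ‖Λ (K - n) y‖ ^ 2
      ≤ (F.L : ℝ) ^ (K - n) * (100 * (2 : ℕ) * (F.L : ℝ) ^ 4
            * (∑ x : Site (F.P K) 0, ∑ μ : Fin (F.P K).d, ∑ ν : Fin (F.P K).d,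
                (if μ < ν then ∑ j : Fin 2, ∑ k : Fin 2,
                  ‖(curl (torusT (F.P K) 0) (fun κ z => unitsField (toUField U₀) ⟨z, κ⟩) (fun κ z => B ⟨z, κ⟩) μ ν x) j k‖ ^ 2 else 0))
          + 10 ^ 9 * (2 : ℕ) ^ 2 * (F.L : ℝ) ^ 9 * ε * (((F.L : ℝ) ^ (K - n)) ^ 2)⁻¹ * ∑ b : PBond (F.P K) 0, ‖B b‖ ^ 2) := by
  refine ⟨?_, ?_⟩
  · -- (i) the identity, guards discharged along the tower
    obtain ⟨_, hε3, hε2, _, _⟩ := smallness_T3 F K hε hεL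
    have hε' : 0 < 2 * ε := by linarith only [hε]
    have hLF : (F.P K).L = F.L := rfl
    have hU' : PlaqSmall (2 * ε * ((((F.P K).L : ℝ) ^ (K - n))⁻¹) ^ 2) U₀ := by
      refine plaqSmall_of_le_of_lt hU ?_
      rw [hLF, inv_pow]
      have hLpos : (0 : ℝ) < (F.L : ℝ) := by have := F.hL.2; exact_mod_cast (by omega : 0 < F.L)
      exact mul_lt_mul_of_pos_right (by linarith only [hε]) (inv_pos.mpr (by positivity))
    have hg := tower_guard (n := Fin 2) (K - n) hε' hε3 hε2 hU'
    intro c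
    exact covConstraint_on_hodge_parts_covD U₀ Q hQ0 hQs Y B φ hY
      (fun (k : ℕ) (Gk : PBond (F.P K) k → Matrix (Fin 2) (Fin 2) ℂ) (z : Site (F.P K) (k + 1)) =>
        ((Fintype.card (Idx (F.P K)) : ℂ))⁻¹ • ∑ i : Idx (F.P K),
          covWalkSum (Averaging.iter (fun i => blockAvg (P := F.P K) (j := i) (expMeanLogSU (n := Fin 2))) k U₀) Gk
            (walk (emb z) (stairWord i.2.1 (off i.1))))
      G Λ hG0 hΛ0 hΛs hGs (K - n) hg c
  · -- (ii) the `(H¹)*`-bound at `Y := B`; the divergence form vanishes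
    have h := sum_normSq_covIterLambda_le_curl_T3_su2 F n K U₀ hε hεL hU B G S Λ hΛ0 hG0 hS0 hΛs hGs hSs
    rw [sum_hs_divB_eq_zero_of_coclosed F K U₀ B hB, add_zero, one_mul] at h
    exact h

end Summit.QuantumFields.YangMills.Theorems.Prop7CovConstraintSplitOfRegPr

end
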